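/-
Origin: expansion seat `prover-pub-hodgecm-mc-carch-1-g3-0`, handover #CA18 2026-08-20T05:25Z md5 2c8acd56e151 (440 l., 32 decls; NEW additive leaf; imports RUN-41 #CA17 Model.ArchKTypeOfSA + K-1 twin Vendored.H21.NumberTheory.GelbartRogawski1991.UnitaryDualPairSeesawCMLinesDeepLevelFixed (glue-2 kit v34, NEW) + installed Vendored…PrincipalCongruenceSubgroupTorsionFree; RUN 42 WITH the K-1 rows, else the run that carries them; drop-alone; cert certs/ax-ArchKTypeOfFin-2c8acd56e151.log: rc 0 / 143 s / 0 warnings / 32/32 trio over private scratch twins of glue-2's 11-file list) (`HOME/mc/pub-hodgecm-mc-carch-1/pkg42/HodgeCM/Model/ArchKTypeOfFin.lean`, md5 2c8acd56e151, 440 lines);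
landed by the second packager p2 gen 3 (p2-g3) in gate run 42 as `HodgeCM/Model/ArchKTypeOfFin.lean` (verbatim).
-/
/-
Copyright (c) 2026. Released under Apache 2.0 license as described in the file LICENSE.
Cell pub-hodgecm, MODEL layer (construction prover mc-carch-1, gen 3), BINDER-OWNERS row 12 `C`: the (D-2) input `hfin` of the row-12 term
DISCHARGED — a deep principal level of `U(V)(𝔸_f)` fixes every `φ_N(Φ_∞)` under the S pin's line representations `lineRepD … k`, `k = 0, 1`.
-/
import Summits.HodgeConjecture.HodgeCM.Model.ArchKTypeOfSA_2
import Literature.NumberTheory.GelbartRogawski1991.UnitaryDualPairSeesawCMLinesDeepLevelFixed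
import Literature.AlgebraicGeometry.ShimuraVarieties.PrincipalCongruenceSubgroupTorsionFree

/-!
# (D-2) at the pin: the deep level `deepLevel V M` and `hfin` for lines 0, 1

The row-12 term (#CA12–#CA17) asks, per line `k` and level `N` of the test functions,
`hfinₖ : ∀ kf ∈ Γ₀.K, ∀ Φ_∞, lineRepD V c.D … η k (regimeEquiv hV (1, kf), 1) (φ_N(Φ_∞)) = φ_N(Φ_∞)` — the finite `K`-type fixes the
whole family `Φ_∞ ⊗ 𝟙_{x₀+N𝒪̂}`.  mc-discharge-2 proved this IN THE TREE for the CM line representations on deep principal congruence levels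
of `U(diag dV)(𝔸_{L,f})` (`UnitaryDualPairSeesawCMLinesDeepLevelFixed`, [GelbartRogawski1991 §3.1, Weil1964 n° 41]); this file transports
it to the S pin (`V.Hm` framed by the rational CM frame `frameG V`, period-1's `lineRepD`), and supplies the LEVEL as a `Level V`:

* § 1 (generic frame `ᵗḡ H g = diag d`) `finFrameCongr : U(H)(𝔸_f) →* U(diag d)(𝔸_f)`, `k_f ↦ (g_𝔸⁻¹ (1, k_f) g_𝔸)_f`, with
  `archPart (cmKTypeHom g (1, k_f)) = 1` and `cmKTypeHom g (1, k_f) = (1, finFrameCongr k_f)` (twin of #CA2 `finPart_cmKTypeHom_archToAdelic`),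
  continuous;
* § 2 **`deepFinLevel V M := K_f(3) ⊓ finFrameCongr⁻¹ K_{U(diag frameD V),f}(M)`** and **`deepLevel V M hM : Level V`** — compact open, its
  arithmetic group `U(L⁺) ∩ K` torsion-free because `≤ Γ(3)` (vendored `torsionFree_of_le_principalCongruenceSubgroup`, [Minkowski]);
* § 3 at the pin: `cmFrameEquiv (frameG V) (regimeEquiv hV (1,k_f)) = (1, finFrameCongr k_f)`, hence
  `lineRepD … 0/1 (regimeEquiv hV (1, k_f), 1) = cmLineRepFin₀/₁ … ((1, finFrameCongr k_f), 1)`, and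
  **`exists_hfin_zero` / `exists_hfin_one`**: `∃ n₀ ≠ 0, ∀ M ≠ 0, n₀ ∣ M → ∀ kf ∈ (deepLevel V M).K, ∀ Φ_∞, lineRepD … k (…) (φ_N(Φ_∞)) = φ_N(Φ_∞)`
  (line 0 under the plane sign `h₁W` at `ι₁` for Weil's majorants — vendored `…CMLinesMajorants` `_of_signs`; line 1 unconditionally);
* § 4 the (D-2) families of #CA17 § 5: `finLevelFamily` (`Γ₀ V c N`), `hfin_zero_family`, `hfin_one_family`.

Nothing is cited here and nothing is minted: kernel lemmas over installed modules + the K-1 twin of the tree's deep-level theorem; 0 records,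
0 `def … : Prop`.
-/

set_option autoImplicit false

noncomputable section

open Filter Topology Complex
open NumberField NumberField.InfinitePlace NumberField.mixedEmbedding IsDedekindDomain MeasureTheory
open scoped Matrix TensorProduct Classical SchwartzMap
open MulAction
open Literature.Geometry.ComplexHyperbolic.BallModel (U21 x₀ stabilizerEquivK21)
open Literature.AlgebraicGeometry.HodgeTheory
open Literature.AlgebraicGeometry.ShimuraVarieties
open Literature.NumberTheory.Automorphic Literature.NumberTheory.Weil1964
open Literature.NumberTheory.GelbartRogawski1991 Literature.NumberTheory.GelbartRogawski1991.UnitaryDualPair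
open Literature.NumberTheory.Automorphic.PicardCM
open HodgeCM.Adelic HodgeCM.PerL34 HodgeCM.Model.HypCensus HodgeCM.Model.SupplyInstance HodgeCM.Model.ArchSideTerm

namespace HodgeCM.Model

/-! ## § 1 The finite-adelic frame transport -/

section Frame

variable (L : Type) [Field L] [NumberField L] [IsCMField L] {N : ℕ} (H : Matrix (Fin N) (Fin N) L)
  (g : GL (Fin N) L) (d : Fin N → L)
  (hg : ((g : Matrix (Fin N) (Fin N) L).map (cmConjRingHom L))ᵀ * H * (g : Matrix (Fin N) (Fin N) L) = Matrix.diagonal d)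

/-- **`k_f ↦ (g_𝔸⁻¹ (1, k_f) g_𝔸)_f : U(H)(𝔸_f) →* U(diag d)(𝔸_f)`**, the finite-adelic frame transport. -/
def finFrameCongr :
    UnitaryGroup.finAdelic (↥(maximalRealSubfield L)) L (IsCMField.complexConj L) N H →*
      UnitaryGroup.finAdelic (↥(maximalRealSubfield L)) L (IsCMField.complexConj L) N (Matrix.diagonal d) :=
  (UnitaryGroup.finPart (↥(maximalRealSubfield L)) L (IsCMField.complexConj L) N (Matrix.diagonal d)).comp
    ((cmKTypeHom L H g d hg).comp
      (UnitaryGroup.finAdelicToAdelic (↥(maximalRealSubfield L)) L (IsCMField.complexConj L) N H))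

/-- (Ported verbatim from the HodgeCMPerL package; no docstring in the source.) -/
theorem finFrameCongr_apply (kf : UnitaryGroup.finAdelic (↥(maximalRealSubfield L)) L (IsCMField.complexConj L) N H) :
    finFrameCongr L H g d hg kf =
      UnitaryGroup.finPart (↥(maximalRealSubfield L)) L (IsCMField.complexConj L) N (Matrix.diagonal d)
        (cmKTypeHom L H g d hg (UnitaryGroup.finAdelicToAdelic (↥(maximalRealSubfield L)) L (IsCMField.complexConj L) N H kf)) :=
  rfl

/-- `finFrameCongr` is continuous. -/
theorem continuous_finFrameCongr : Continuous (finFrameCongr L H g d hg) :=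
  (UnitaryGroup.continuous_finPart _ _ _ _ _).comp
    ((continuous_cmKTypeHom L H g d hg).comp (UnitaryGroup.continuous_finAdelicToAdelic _ _ _ _ _))

/-- **`(g_𝔸⁻¹ (1, k_f) g_𝔸)_∞ = 1`**: the frame transport of a finite-adelic element has trivial archimedean part. -/
theorem archPart_cmKTypeHom_finAdelicToAdelic
    (kf : UnitaryGroup.finAdelic (↥(maximalRealSubfield L)) L (IsCMField.complexConj L) N H) :
    UnitaryGroup.archPart (↥(maximalRealSubfield L)) L (IsCMField.complexConj L) N (Matrix.diagonal d)
        (cmKTypeHom L H g d hg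
          (UnitaryGroup.finAdelicToAdelic (↥(maximalRealSubfield L)) L (IsCMField.complexConj L) N H kf)) = 1 := by
  apply Subtype.ext
  rw [UnitaryGroup.coe_archPart, OneMemClass.coe_one]
  change GLn.toMixed N L ((cmKTypeHom L H g d hg
      (UnitaryGroup.finAdelicToAdelic (↥(maximalRealSubfield L)) L (IsCMField.complexConj L) N H kf) :
        ↥(UnitaryGroup.adelic (↥(maximalRealSubfield L)) L (IsCMField.complexConj L) N (Matrix.diagonal d))) :
          GL (Fin N) (AdeleRing (𝓞 L) L)) = 1
  rw [coe_cmKTypeHom, map_mul, map_mul, map_inv]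
  change (GLn.toMixed N L (Literature.NumberTheory.Automorphic.toAdeleGL L g))⁻¹ *
      GLn.toMixed N L (GLn.ofFinite N L (kf : GL (Fin N) (FiniteAdeleRing (𝓞 L) L))) *
        GLn.toMixed N L (Literature.NumberTheory.Automorphic.toAdeleGL L g) = 1
  rw [GLn.toMixed_apply N L (GLn.ofFinite N L _), GLn.fstHom_ofFinite, map_one, mul_one, inv_mul_cancel]

/-- **`g_𝔸⁻¹ (1, k_f) g_𝔸 = (1, finFrameCongr k_f)`**. -/
theorem finAdelicToAdelic_finFrameCongr
    (kf : UnitaryGroup.finAdelic (↥(maximalRealSubfield L)) L (IsCMField.complexConj L) N H) :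
    UnitaryGroup.finAdelicToAdelic (↥(maximalRealSubfield L)) L (IsCMField.complexConj L) N (Matrix.diagonal d)
        (finFrameCongr L H g d hg kf) =
      cmKTypeHom L H g d hg (UnitaryGroup.finAdelicToAdelic (↥(maximalRealSubfield L)) L (IsCMField.complexConj L) N H kf) := by
  have h := UnitaryGroup.archToAdelic_mul_finAdelicToAdelic (↥(maximalRealSubfield L)) L (IsCMField.complexConj L) N
    (Matrix.diagonal d)
    (cmKTypeHom L H g d hg (UnitaryGroup.finAdelicToAdelic (↥(maximalRealSubfield L)) L (IsCMField.complexConj L) N H kf))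
  rw [archPart_cmKTypeHom_finAdelicToAdelic, map_one, one_mul] at h
  exact h

end Frame

/-! ## § 2 The deep level of `U(V)(𝔸_f)` as a `Level V` -/

section DeepLevel

variable {L : CMField} {ι₁ : L →+* ℂ} (V : HermSpace3 L ι₁)

/-- the span ideal `(n) ⊆ 𝓞 L` is non-zero for `n ≠ 0`. -/
theorem span_natCast_ne_zero {n : ℕ} (hn : n ≠ 0) : (Ideal.span {((n : ℕ) : 𝓞 L)} : Ideal (𝓞 L)) ≠ 0 := by
  rw [Ne, Ideal.zero_eq_bot, Ideal.span_singleton_eq_bot]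
  exact_mod_cast hn

/-- **the deep finite level**: `K_f(3) ∩ finFrameCongr⁻¹ (K_{U(diag frameD V),f}(M))` inside `U(V.Hm)(𝔸_{L,f})`. -/
def deepFinLevel (M : ℕ) : Subgroup V.adelicFin :=
  UnitaryGroup.finCongruenceLevel (↥(maximalRealSubfield L)) (L : Type) (IsCMField.complexConj L) 3 V.Hm (Ideal.span {((3 : ℕ) : 𝓞 L)}) ⊓
    (UnitaryGroup.finCongruenceLevel (↥(maximalRealSubfield L)) (L : Type) (IsCMField.complexConj L) 3 (Matrix.diagonal (frameD V))
        (Ideal.span {(M : 𝓞 L)})).comap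
      (finFrameCongr (L : Type) V.Hm (frameG V) (frameD V) (frame_congr V))

/-- (Ported verbatim from the HodgeCMPerL package; no docstring in the source.) -/
theorem deepFinLevel_le_three (M : ℕ) :
    deepFinLevel V M ≤
      UnitaryGroup.finCongruenceLevel (↥(maximalRealSubfield L)) (L : Type) (IsCMField.complexConj L) 3 V.Hm (Ideal.span {((3 : ℕ) : 𝓞 L)}) :=
  inf_le_left

/-- membership: the framed finite component lies in `K_{U(diag frameD V),f}(M)`. -/
theorem mem_deepFinLevel_iff {M : ℕ} {kf : V.adelicFin} :
    kf ∈ deepFinLevel V M ↔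
      kf ∈ UnitaryGroup.finCongruenceLevel (↥(maximalRealSubfield L)) (L : Type) (IsCMField.complexConj L) 3 V.Hm
          (Ideal.span {((3 : ℕ) : 𝓞 L)}) ∧
        finFrameCongr (L : Type) V.Hm (frameG V) (frameD V) (frame_congr V) kf ∈
          UnitaryGroup.finCongruenceLevel (↥(maximalRealSubfield L)) (L : Type) (IsCMField.complexConj L) 3 (Matrix.diagonal (frameD V))
            (Ideal.span {(M : 𝓞 L)}) := by
  rw [deepFinLevel, Subgroup.mem_inf, Subgroup.mem_comap]

/-- (Ported verbatim from the HodgeCMPerL package; no docstring in the source.) -/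
theorem finFrameCongr_mem_of_mem_deepFinLevel {M : ℕ} {kf : V.adelicFin} (h : kf ∈ deepFinLevel V M) :
    finFrameCongr (L : Type) V.Hm (frameG V) (frameD V) (frame_congr V) kf ∈
      UnitaryGroup.finCongruenceLevel (↥(maximalRealSubfield L)) (L : Type) (IsCMField.complexConj L) 3 (Matrix.diagonal (frameD V))
        (Ideal.span {(M : 𝓞 L)}) :=
  ((mem_deepFinLevel_iff V).1 h).2

/-- (Ported verbatim from the HodgeCMPerL package; no docstring in the source.) -/
theorem isOpen_deepFinLevel {M : ℕ} (hM : M ≠ 0) : IsOpen (deepFinLevel V M : Set V.adelicFin) := by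
  have h3 := UnitaryGroup.isOpen_finCongruenceLevel (F := ↥(maximalRealSubfield L)) (E := (L : Type))
    (c := IsCMField.complexConj L) (N := 3) (J := V.Hm) (span_natCast_ne_zero (L := L) (n := 3) (by norm_num))
  have hM' := UnitaryGroup.isOpen_finCongruenceLevel (F := ↥(maximalRealSubfield L)) (E := (L : Type))
    (c := IsCMField.complexConj L) (N := 3) (J := Matrix.diagonal (frameD V)) (span_natCast_ne_zero (L := L) hM)
  rw [deepFinLevel, Subgroup.coe_inf, Subgroup.coe_comap]
  exact h3.inter (hM'.preimage (continuous_finFrameCongr (L : Type) V.Hm (frameG V) (frameD V) (frame_congr V)))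

/-- (Ported verbatim from the HodgeCMPerL package; no docstring in the source.) -/
theorem isCompact_deepFinLevel {M : ℕ} (hM : M ≠ 0) : IsCompact (deepFinLevel V M : Set V.adelicFin) := by
  have h3 := UnitaryGroup.isCompact_finCongruenceLevel (F := ↥(maximalRealSubfield L)) (E := (L : Type))
    (c := IsCMField.complexConj L) (N := 3) (J := V.Hm) (span_natCast_ne_zero (L := L) (n := 3) (by norm_num))
  have hM' := UnitaryGroup.isOpen_finCongruenceLevel (F := ↥(maximalRealSubfield L)) (E := (L : Type))
    (c := IsCMField.complexConj L) (N := 3) (J := Matrix.diagonal (frameD V)) (span_natCast_ne_zero (L := L) hM)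
  rw [deepFinLevel, Subgroup.coe_inf, Subgroup.coe_comap]
  exact h3.inter_right ((Subgroup.isClosed_of_isOpen _ hM').preimage
    (continuous_finFrameCongr (L : Type) V.Hm (frameG V) (frameD V) (frame_congr V)))

/-- the arithmetic group of the deep level lies in `Γ(3)`. -/
theorem arithmeticLevel_deepFinLevel_le (M : ℕ) :
    UnitaryGroup.arithmeticLevel (↥(maximalRealSubfield L)) (L : Type) (IsCMField.complexConj L) 3 V.Hm (deepFinLevel V M) ≤
      principalCongruenceSubgroup ((IsCMField.complexConj L : (L : Type) ≃ₐ[↥(maximalRealSubfield L)] L) : (L : Type) →+* L) V.Hm 3 := by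
  rw [← UnitaryGroup.arithmeticLevel_finCongruenceLevel_span (F := ↥(maximalRealSubfield L)) (E := (L : Type))
    (c := IsCMField.complexConj L) (N := 3) (J := V.Hm) (n := 3) (by norm_num)]
  exact UnitaryGroup.arithmeticLevel_mono (deepFinLevel_le_three V M)

/-- **THE DEEP LEVEL `(U(L⁺) ∩ K, K := deepFinLevel V M)` as a `Level V`** — compact open, arithmetic group torsion-free (`≤ Γ(3)`, [Minkowski]). -/
def deepLevel (M : ℕ) (hM : M ≠ 0) : Level V where
  Γ := UnitaryGroup.arithmeticLevel (↥(maximalRealSubfield L)) (L : Type) (IsCMField.complexConj L) 3 V.Hm (deepFinLevel V M)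
  K := deepFinLevel V M
  isCompact_K := isCompact_deepFinLevel V hM
  isOpen_K := isOpen_deepFinLevel V hM
  arithmeticLevel_K := rfl
  torsionFree := torsionFree_of_le_principalCongruenceSubgroup (by norm_num) (arithmeticLevel_deepFinLevel_le V M)

/-- (Ported verbatim from the HodgeCMPerL package; no docstring in the source.) -/
@[simp] theorem deepLevel_K (M : ℕ) (hM : M ≠ 0) : (deepLevel V M hM).K = deepFinLevel V M := rfl

end DeepLevel

/-! ## § 3 `hfin` at the pin for lines 0 and 1 -/

section Fin

variable {L : CMField} {ι₁ : L →+* ℂ} (V : HermSpace3 L ι₁) (S : StubTree.SeesawDatum L)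
variable
  (hGR : (cmSplittingDatum (L : Type) finProdFinEquiv (frameD V) (frameD_real V) (frameD_ne V) (dW S) (dW_real S) (dW_ne S)).CompatibleSplitting)
  (hGR₀ : (cmSplittingDatum (L : Type) (e₁) (frameD V) (frameD_real V) (frameD_ne V) (lineVec (L : Type) (dW S 0))
    (fun _ => dW_real S 0) (fun _ => dW_ne S 0)).CompatibleSplitting)
  (hGR₁ : (cmSplittingDatum (L : Type) (e₁) (frameD V) (frameD_real V) (frameD_ne V) (lineVec (L : Type) (dW S 1))
    (fun _ => dW_real S 1) (fun _ => dW_ne S 1)).CompatibleSplitting)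
  (hGR₂ : (cmSplittingDatum (L : Type) (e₁) (frameD V) (frameD_real V) (frameD_ne V) (lineVec (L : Type) (dW' S 0))
    (fun _ => dW'_real S 0) (fun _ => dW'_ne S 0)).CompatibleSplitting)
  (hGR₃ : (cmSplittingDatum (L : Type) (e₁) (frameD V) (frameD_real V) (frameD_ne V) (lineVec (L : Type) (dW' S 1))
    (fun _ => dW'_real S 1) (fun _ => dW'_ne S 1)).CompatibleSplitting)
  (η : CMAdelic (L : Type) (frameD V) × CMAdelic (L : Type) (dW S) →* ℂˣ)
  (hV : IsAnisotropic L V.Hm)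

/-- the first factor of `lineRepD k` at a finite-adelic regime element is `(1, finFrameCongr k_f)`. -/
theorem cmFrameEquiv_regime_finAdelicToAdelic
    (kf : UnitaryGroup.finAdelic (↥(maximalRealSubfield L)) L (IsCMField.complexConj L) 3 V.Hm) :
    cmFrameEquiv (L : Type) (frameG V) V.Hm (frameD V) (frame_congr V)
        ((regimeSubgroup L V.Hm).subtype
          (HodgeCM.Adelic.regimeEquiv L V.Hm hV
            (UnitaryGroup.finAdelicToAdelic (↥(maximalRealSubfield L)) L (IsCMField.complexConj L) 3 V.Hm kf))) =
      UnitaryGroup.finAdelicToAdelic (↥(maximalRealSubfield L)) L (IsCMField.complexConj L) 3 (Matrix.diagonal (frameD V))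
        (finFrameCongr (L : Type) V.Hm (frameG V) (frameD V) (frame_congr V) kf) := by
  rw [Subgroup.coe_subtype, coe_regimeEquiv, finAdelicToAdelic_finFrameCongr, cmKTypeHom_apply]
  rfl

/-- **line 0**: `lineRepD 0 (regimeEquiv hV (1, k_f), 1) = cmLineRepFin₀ η₀ ((1, finFrameCongr k_f), 1)`. -/
theorem lineRepD_zero_regime_finAdelic
    (kf : UnitaryGroup.finAdelic (↥(maximalRealSubfield L)) L (IsCMField.complexConj L) 3 V.Hm) :
    lineRepD V S hGR hGR₀ hGR₁ hGR₂ hGR₃ η 0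
        (HodgeCM.Adelic.regimeEquiv L V.Hm hV
          (UnitaryGroup.finAdelicToAdelic (↥(maximalRealSubfield L)) L (IsCMField.complexConj L) 3 V.Hm kf), 1) =
      cmLineRepFin₀ (L : Type) finProdFinEquiv e₁ (frameD V) (frameD_real V) (frameD_ne V) (dW S) (dW_real S) (dW_ne S)
        hGR hGR₀ hGR₁ (eta₀ V S η)
        (UnitaryGroup.finAdelicToAdelic (↥(maximalRealSubfield L)) L (IsCMField.complexConj L) 3 (Matrix.diagonal (frameD V))
          (finFrameCongr (L : Type) V.Hm (frameG V) (frameD V) (frame_congr V) kf), 1) := by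
  rw [← cmFrameEquiv_regime_finAdelicToAdelic V hV kf]
  rfl

/-- **line 1**: `lineRepD 1 (regimeEquiv hV (1, k_f), 1) = cmLineRepFin₁ η₁ ((1, finFrameCongr k_f), 1)`. -/
theorem lineRepD_one_regime_finAdelic
    (kf : UnitaryGroup.finAdelic (↥(maximalRealSubfield L)) L (IsCMField.complexConj L) 3 V.Hm) :
    lineRepD V S hGR hGR₀ hGR₁ hGR₂ hGR₃ η 1
        (HodgeCM.Adelic.regimeEquiv L V.Hm hV
          (UnitaryGroup.finAdelicToAdelic (↥(maximalRealSubfield L)) L (IsCMField.complexConj L) 3 V.Hm kf), 1) =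
      cmLineRepFin₁ (L : Type) finProdFinEquiv e₁ (frameD V) (frameD_real V) (frameD_ne V) (dW S) (dW_real S) (dW_ne S)
        hGR hGR₀ hGR₁ (eta₁ V S η)
        (UnitaryGroup.finAdelicToAdelic (↥(maximalRealSubfield L)) L (IsCMField.complexConj L) 3 (Matrix.diagonal (frameD V))
          (finFrameCongr (L : Type) V.Hm (frameG V) (frameD V) (frame_congr V) kf), 1) := by
  rw [← cmFrameEquiv_regime_finAdelicToAdelic V hV kf]
  rfl

/-- **(D-2) FOR LINE 0 in `U(diag frameD V)(𝔸_f)` currency** (the K-1 twin of the tree theorem at the pin's data; `hV`-free): under the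
plane sign `h₁W` at `ι₁` (Weil's majorants, vendored `…CMLinesMajorants` `_of_signs`) and continuity of `η`, for every base point `x` and test
level `N` there is `n₀ ≠ 0` such that every `k ∈ K_{U(diag frameD V),f}(M)`, `n₀ ∣ M ≠ 0`, fixes every `φ_N(Φ_∞)` under `cmLineRepFin₀ η₀`.
[tree: GelbartRogawski1991 §3.1 Remark p. 457; Weil1964 n° 41 Thm 6] -/
theorem exists_deepFix_zero (hηc : Continuous fun p => ((η p : ℂˣ) : ℂ))
    (h₁W : (∀ j, 0 < (ι₁ (dW S j)).re) ∨ ∀ j, (ι₁ (dW S j)).re < 0)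
    (x : Fin 3 → ↥(maximalRealSubfield L)) (N : ℕ) :
    ∃ n₀ : ℕ, n₀ ≠ 0 ∧ ∀ M : ℕ, M ≠ 0 → n₀ ∣ M →
      ∀ k ∈ UnitaryGroup.finCongruenceLevel (↥(maximalRealSubfield L)) (L : Type) (IsCMField.complexConj L) 3
          (Matrix.diagonal (frameD V)) (Ideal.span {(M : 𝓞 L)}),
        ∀ Φinf : 𝓢((Fin 3 → mixedSpace (↥(maximalRealSubfield L))), ℂ),
          cmLineRepFin₀ (L : Type) finProdFinEquiv e₁ (frameD V) (frameD_real V) (frameD_ne V) (dW S) (dW_real S) (dW_ne S)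
              hGR hGR₀ hGR₁ (eta₀ V S η)
              (UnitaryGroup.finAdelicToAdelic (↥(maximalRealSubfield L)) L (IsCMField.complexConj L) 3 (Matrix.diagonal (frameD V)) k, 1)
              (testFun (↥(maximalRealSubfield L)) (Fin 3) Φinf x N) =
            testFun (↥(maximalRealSubfield L)) (Fin 3) Φinf x N := by
  obtain ⟨n₀, hn₀, hfix⟩ :=
    exists_nat_forall_dvd_finCongruenceLevel_forall_cmLineRepFin₀_thinCosetTestFunₗ_eq_self (L : Type) finProdFinEquiv e₁
      (frameD V) (frameD_real V) (frameD_ne V) (dW S) (dW_real S) (dW_ne S) hGR hGR₀ hGR₁ (eta₀ V S η)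
      (hasThetaMajorants_cmPairSplitting_of_signs_two (L : Type) finProdFinEquiv (frameD V) (frameD_real V) (frameD_ne V) (dW S)
        (dW_real S) (dW_ne S) ι₁ hGR (frameD_sign_ι₁' V) h₁W (frameD_sign_of_ne V))
      (hasThetaMajorants_omega_pairSmall₁_lineVec_of_signs (L : Type) e₁ (frameD V) (frameD_real V) (frameD_ne V) (dW S 0)
        (dW_real S 0) (dW_ne S 0) hGR₀ ι₁ (frameD_sign_ι₁' V) (frameD_sign_of_ne V))
      (hasThetaMajorants_omega_pairSmall₂_lineVec_of_signs (L : Type) e₁ (frameD V) (frameD_real V) (frameD_ne V) (dW S 1)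
        (dW_real S 1) (dW_ne S 1) hGR₁ ι₁ (frameD_sign_ι₁' V) (frameD_sign_of_ne V))
      (continuous_cmEta₀ (L : Type) (frameD V) (dW S) η hηc) (A := Unit)
      (fun _ => finEmb (↥(maximalRealSubfield L)) (Fin 3) x) (fun _ => Ideal.span {(N : 𝓞 ↥(maximalRealSubfield L))})
  exact ⟨n₀, hn₀, fun M hM hdvd k hk Φinf => hfix M hM hdvd k hk () Φinf⟩

/-- **(D-2) FOR LINE 1 in `U(diag frameD V)(𝔸_f)` currency** (no sign hypothesis: the second line's small character is trivial on `U(V)`). -/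
theorem exists_deepFix_one (hηc : Continuous fun p => ((η p : ℂˣ) : ℂ))
    (x : Fin 3 → ↥(maximalRealSubfield L)) (N : ℕ) :
    ∃ n₀ : ℕ, n₀ ≠ 0 ∧ ∀ M : ℕ, M ≠ 0 → n₀ ∣ M →
      ∀ k ∈ UnitaryGroup.finCongruenceLevel (↥(maximalRealSubfield L)) (L : Type) (IsCMField.complexConj L) 3
          (Matrix.diagonal (frameD V)) (Ideal.span {(M : 𝓞 L)}),
        ∀ Φinf : 𝓢((Fin 3 → mixedSpace (↥(maximalRealSubfield L))), ℂ),
          cmLineRepFin₁ (L : Type) finProdFinEquiv e₁ (frameD V) (frameD_real V) (frameD_ne V) (dW S) (dW_real S) (dW_ne S)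
              hGR hGR₀ hGR₁ (eta₁ V S η)
              (UnitaryGroup.finAdelicToAdelic (↥(maximalRealSubfield L)) L (IsCMField.complexConj L) 3 (Matrix.diagonal (frameD V)) k, 1)
              (testFun (↥(maximalRealSubfield L)) (Fin 3) Φinf x N) =
            testFun (↥(maximalRealSubfield L)) (Fin 3) Φinf x N := by
  obtain ⟨n₀, hn₀, hfix⟩ :=
    exists_nat_forall_dvd_finCongruenceLevel_forall_cmLineRepFin₁_thinCosetTestFunₗ_eq_self (L : Type) finProdFinEquiv e₁
      (frameD V) (frameD_real V) (frameD_ne V) (dW S) (dW_real S) (dW_ne S) hGR hGR₀ hGR₁ (eta₁ V S η)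
      (continuous_cmEta₁_comp_snd (L : Type) (frameD V) (dW S) η hηc) (A := Unit)
      (fun _ => finEmb (↥(maximalRealSubfield L)) (Fin 3) x) (fun _ => Ideal.span {(N : 𝓞 ↥(maximalRealSubfield L))})
  exact ⟨n₀, hn₀, fun M hM hdvd k hk Φinf => hfix M hM hdvd k hk () Φinf⟩

/-- **the (D-2) index of line 0** (`n₀` of `exists_deepFix_zero`, chosen). -/
def deepIndexZero (hηc : Continuous fun p => ((η p : ℂˣ) : ℂ))
    (h₁W : (∀ j, 0 < (ι₁ (dW S j)).re) ∨ ∀ j, (ι₁ (dW S j)).re < 0) (x : Fin 3 → ↥(maximalRealSubfield L)) (N : ℕ) : ℕ :=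
  Classical.choose (exists_deepFix_zero V S hGR hGR₀ hGR₁ η hηc h₁W x N)

/-- (Ported verbatim from the HodgeCMPerL package; no docstring in the source.) -/
theorem deepIndexZero_ne_zero (hηc : Continuous fun p => ((η p : ℂˣ) : ℂ))
    (h₁W : (∀ j, 0 < (ι₁ (dW S j)).re) ∨ ∀ j, (ι₁ (dW S j)).re < 0) (x : Fin 3 → ↥(maximalRealSubfield L)) (N : ℕ) :
    deepIndexZero V S hGR hGR₀ hGR₁ η hηc h₁W x N ≠ 0 :=
  (Classical.choose_spec (exists_deepFix_zero V S hGR hGR₀ hGR₁ η hηc h₁W x N)).1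

/-- **the (D-2) index of line 1**. -/
def deepIndexOne (hηc : Continuous fun p => ((η p : ℂˣ) : ℂ)) (x : Fin 3 → ↥(maximalRealSubfield L)) (N : ℕ) : ℕ :=
  Classical.choose (exists_deepFix_one V S hGR hGR₀ hGR₁ η hηc x N)

/-- (Ported verbatim from the HodgeCMPerL package; no docstring in the source.) -/
theorem deepIndexOne_ne_zero (hηc : Continuous fun p => ((η p : ℂˣ) : ℂ)) (x : Fin 3 → ↥(maximalRealSubfield L)) (N : ℕ) :
    deepIndexOne V S hGR hGR₀ hGR₁ η hηc x N ≠ 0 :=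
  (Classical.choose_spec (exists_deepFix_one V S hGR hGR₀ hGR₁ η hηc x N)).1

/-- **`hfin` FOR LINE 0 AT THE PIN on every deep level `deepLevel V M`, `deepIndexZero ∣ M`.** -/
theorem hfin_zero_deepLevel (hηc : Continuous fun p => ((η p : ℂˣ) : ℂ))
    (h₁W : (∀ j, 0 < (ι₁ (dW S j)).re) ∨ ∀ j, (ι₁ (dW S j)).re < 0) (x : Fin 3 → ↥(maximalRealSubfield L)) (N : ℕ)
    {M : ℕ} (hM : M ≠ 0) (hdvd : deepIndexZero V S hGR hGR₀ hGR₁ η hηc h₁W x N ∣ M) :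
    ∀ kf : UnitaryGroup.finAdelic (↥(maximalRealSubfield L)) L (IsCMField.complexConj L) 3 V.Hm, kf ∈ (deepLevel V M hM).K →
      ∀ Φinf : 𝓢((Fin 3 → mixedSpace (↥(maximalRealSubfield L))), ℂ),
        lineRepD V S hGR hGR₀ hGR₁ hGR₂ hGR₃ η 0
            (HodgeCM.Adelic.regimeEquiv L V.Hm hV
              (UnitaryGroup.finAdelicToAdelic (↥(maximalRealSubfield L)) L (IsCMField.complexConj L) 3 V.Hm kf), 1)
            (testFun (↥(maximalRealSubfield L)) (Fin 3) Φinf x N) =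
          testFun (↥(maximalRealSubfield L)) (Fin 3) Φinf x N := by
  intro kf hkf Φinf
  rw [lineRepD_zero_regime_finAdelic V S hGR hGR₀ hGR₁ hGR₂ hGR₃ η hV kf]
  exact (Classical.choose_spec (exists_deepFix_zero V S hGR hGR₀ hGR₁ η hηc h₁W x N)).2 M hM hdvd _
    (finFrameCongr_mem_of_mem_deepFinLevel V hkf) Φinf

/-- **`hfin` FOR LINE 1 AT THE PIN on every deep level `deepLevel V M`, `deepIndexOne ∣ M`.** -/
theorem hfin_one_deepLevel (hηc : Continuous fun p => ((η p : ℂˣ) : ℂ)) (x : Fin 3 → ↥(maximalRealSubfield L)) (N : ℕ)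
    {M : ℕ} (hM : M ≠ 0) (hdvd : deepIndexOne V S hGR hGR₀ hGR₁ η hηc x N ∣ M) :
    ∀ kf : UnitaryGroup.finAdelic (↥(maximalRealSubfield L)) L (IsCMField.complexConj L) 3 V.Hm, kf ∈ (deepLevel V M hM).K →
      ∀ Φinf : 𝓢((Fin 3 → mixedSpace (↥(maximalRealSubfield L))), ℂ),
        lineRepD V S hGR hGR₀ hGR₁ hGR₂ hGR₃ η 1
            (HodgeCM.Adelic.regimeEquiv L V.Hm hV
              (UnitaryGroup.finAdelicToAdelic (↥(maximalRealSubfield L)) L (IsCMField.complexConj L) 3 V.Hm kf), 1)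
            (testFun (↥(maximalRealSubfield L)) (Fin 3) Φinf x N) =
          testFun (↥(maximalRealSubfield L)) (Fin 3) Φinf x N := by
  intro kf hkf Φinf
  rw [lineRepD_one_regime_finAdelic V S hGR hGR₀ hGR₁ hGR₂ hGR₃ η hV kf]
  exact (Classical.choose_spec (exists_deepFix_one V S hGR hGR₀ hGR₁ η hηc x N)).2 M hM hdvd _
    (finFrameCongr_mem_of_mem_deepFinLevel V hkf) Φinf

end Fin

/-! ## § 4 The (D-2) families of #CA17 § 5: the supply level `Γ₀ V c N`, `hfin₀`, `hfin₁` -/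

section Family

variable
  (hGR : ∀ {L : CMField} {ι₁ : L →+* ℂ} (V : HermSpace3 L ι₁) (c : SeesawCtx L),
    (cmSplittingDatum (L : Type) finProdFinEquiv (frameD V) (frameD_real V) (frameD_ne V) (dW c.D) (dW_real c.D)
      (dW_ne c.D)).CompatibleSplitting)
  (η : ∀ {L : CMField} {ι₁ : L →+* ℂ} (V : HermSpace3 L ι₁) (c : SeesawCtx L),
    CMAdelic (L : Type) (frameD V) × CMAdelic (L : Type) (dW c.D) →* ℂˣ)
  (hηc : ∀ {L : CMField} {ι₁ : L →+* ℂ} (V : HermSpace3 L ι₁) (c : SeesawCtx L), Continuous fun p => ((η V c p : ℂˣ) : ℂ))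
  (hGR₀ : ∀ {L : CMField} {ι₁ : L →+* ℂ} (V : HermSpace3 L ι₁) (c : SeesawCtx L),
    (cmSplittingDatum (L : Type) (e₁) (frameD V) (frameD_real V) (frameD_ne V) (lineVec (L : Type) (dW c.D 0))
      (fun _ => dW_real c.D 0) (fun _ => dW_ne c.D 0)).CompatibleSplitting)
  (hGR₁ : ∀ {L : CMField} {ι₁ : L →+* ℂ} (V : HermSpace3 L ι₁) (c : SeesawCtx L),
    (cmSplittingDatum (L : Type) (e₁) (frameD V) (frameD_real V) (frameD_ne V) (lineVec (L : Type) (dW c.D 1))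
      (fun _ => dW_real c.D 1) (fun _ => dW_ne c.D 1)).CompatibleSplitting)
  (hGR₂ : ∀ {L : CMField} {ι₁ : L →+* ℂ} (V : HermSpace3 L ι₁) (c : SeesawCtx L),
    (cmSplittingDatum (L : Type) (e₁) (frameD V) (frameD_real V) (frameD_ne V) (lineVec (L : Type) (dW' c.D 0))
      (fun _ => dW'_real c.D 0) (fun _ => dW'_ne c.D 0)).CompatibleSplitting)
  (hGR₃ : ∀ {L : CMField} {ι₁ : L →+* ℂ} (V : HermSpace3 L ι₁) (c : SeesawCtx L),
    (cmSplittingDatum (L : Type) (e₁) (frameD V) (frameD_real V) (frameD_ne V) (lineVec (L : Type) (dW' c.D 1))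
      (fun _ => dW'_real c.D 1) (fun _ => dW'_ne c.D 1)).CompatibleSplitting)
  (μ : ∀ {L : CMField}, SeesawCtx L → Fin 4 → NumberField.InfinitePlace L → ℤ)
  (𝔄 : ∀ {L : CMField} {ι₁ : L →+* ℂ} (V : HermSpace3 L ι₁) (c : SeesawCtx L),
    ArchLineDatum V c.D (hGR V c) (hGR₀ V c) (hGR₁ V c) (hGR₂ V c) (hGR₃ V c) (η V c) (μ c))

variable {L : CMField} {ι₁ : L →+* ℂ} (V : HermSpace3 L ι₁) (c : SeesawCtx L)

/-- **the deep-level index of a context at test level `N`**: the product of the two lines' (D-2) indices at the datum's base points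
`(𝔄 V c).x₀ 0 / 1` when the plane `⟨a₀, a₁⟩` is definite at `ι₁` (the case E reads; line 0's index needs it for Weil's majorants), `1` otherwise —
TOTAL in `(V, c, N)`, free of `hV` and of any guard. -/
def finLevelIndex (N : ℕ) : ℕ :=
  if h : (∀ j, 0 < (ι₁ (dW c.D j)).re) ∨ ∀ j, (ι₁ (dW c.D j)).re < 0 then
    deepIndexZero V c.D (hGR V c) (hGR₀ V c) (hGR₁ V c) (η V c) (hηc V c) h ((𝔄 V c).x₀ 0) N *
      deepIndexOne V c.D (hGR V c) (hGR₀ V c) (hGR₁ V c) (η V c) (hηc V c) ((𝔄 V c).x₀ 1) N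
  else 1


-- port_pkg: scope closed for this part
end Family
end HodgeCM.Model
end
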